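import Literature.Analysis.Complex.PhaseLevelCrossings
import Literature.Analysis.Complex.EdgePhaseTracking
import Literature.Analysis.Complex.ReflectedSumOrder
import HarnessLib

/-!
# Levinson–Conrey zero detection on an edge: zeros of `Q + Q♯` from the argument of `Q`

Trunk T-ANALYSIS support (`Literature/Analysis/Complex`). Assembly of the generic part of the
first step of Levinson's method in Conrey's arrangement (J. B. Conrey, *J. Number Theory* 16
(1983), §4, (1)–(3)). Let `Q` be analytic at every point of the closed rectangle
`R = [a,b] × [c,d]` (`a < b`, `c < d`) and non-zero on its bottom, top and right edges, and put
`Q♯(s) = conj Q(2a − s̄)` (reflection in the left edge; on it `Q + Q♯ = 2 Re Q`). Then the zeros of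
`Q + Q♯` on the open left edge `{a} × (c, d)`, counted with multiplicity, number at least

  `(1/π) · (Im ∫_a^b (Q'/Q)(x+ic) dx − Im ∫_a^b (Q'/Q)(x+id) dx + ∫_c^d Re (Q'/Q)(b+it) dt) − 2 N − 1`,

where `N` is the number of zeros of `Q` inside `R` (with multiplicity)
(`levinsonConrey_zeroDetection`). In Levinson's method `R = [½, σ₀] × [T, T+U]`, `Q = H·V` with
`K ξ = Q + Q♯`, the first bracket is `Δ arg H + O(log T) = π (N(T+U) − N(T)) + O(log T)` and the
conclusion is Conrey's (2)–(3): `N₀(T+U) − N₀(T) ≥ N(T+U) − N(T) − 2N + O(log T)`.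

The proof is the concatenation of the tree's generic pieces:
* `Literature.Analysis.Complex.integral_re_logDeriv_left_add_finsum_eq` (`ArgumentPrincipleEdgeZeros.lean`):
  the bracket equals `Φ(d) − Φ(c)` for the phase-with-jumps
  `Φ(t) = arg Q(a+ic) + ∫_c^t Re(Q'/Q)(a+iu) du + π Σ_{zeros a+is, s<t} m`, plus `2πN`;
* `Literature.Analysis.Complex.exists_finset_cos_jumpPhase_eq_zero` (`PhaseLevelCrossings.lean`):
  `(Φ(d) − Φ(c))/π − 1 ≤ #F + Σ_s (m_s + [cos Φ(s⁻) = 0])` with `cos Φ = 0` on `F`;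
* `Literature.Analysis.Complex.leftEdge_phase_eq_sum` (`EdgePhaseTracking.lean`): `Φ` is the
  argument of `Q` off its zeros, so `Re Q = 0`, i.e. `Q + Q♯ = 0`, on `F`;
* `Literature.Analysis.Complex.exp_leftEdge_phase_at_zero` and
  `Literature.Analysis.Complex.succ_le_analyticOrderAt_add_reflect` (`ReflectedSumOrder.lean`): at a zero
  `a + is` of `Q` of multiplicity `m_s`, `Q + Q♯` vanishes to order `≥ m_s`, and to order
  `≥ m_s + 1` exactly in the flagged case.

## Main results

* `levinsonConrey_zeroDetection_phase` — the count against `Φ(d) − Φ(c)`.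
* `levinsonConrey_zeroDetection` — the count against the three-edge boundary terms and `N`.

## References

* J. B. Conrey, *Zeros of derivatives of Riemann's ξ-function on the critical line*, J. Number
  Theory 16 (1983), 49–74, §4 (1)–(3). [Conrey1983]
* N. Levinson, *More than one third of zeros of Riemann's zeta-function are on `σ = 1/2`*,
  Adv. Math. 13 (1974), 383–436.
-/

noncomputable section

open Complex Set MeasureTheory Filter Topology intervalIntegral
open scoped ComplexConjugate

namespace Literature.Analysis.Complex

variable {a b c d : ℝ}

/-- A finite order, bounded below by a natural number, has at least that `toNat`. [folklore] -/
private lemma le_toNat_of_coe_le {k : ℕ} {o : ℕ∞} (h : (k : ℕ∞) ≤ o) (ho : o ≠ ⊤) : k ≤ o.toNat := by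
  lift o to ℕ using ho
  simpa using h

/-- **Levinson–Conrey zero detection, phase form.** Let `Q` be analytic at every point of the
closed rectangle `[a,b] × [c,d]` (`a < b`, `c < d`), non-zero on the bottom, top and right edges,
and suppose `Q + Q♯` (`Q♯(s) = conj Q(2a − s̄)`) has finite order at every point of the open left
edge. Then there is a finite set `Z ⊆ (c, d)` of ordinates of zeros of `Q + Q♯` on the left edge
whose multiplicities add up to at least
`(1/π) (∫_c^d Re (Q'/Q)(a+it) dt + π Σ_{c<s<d, Q(a+is)=0} m(a+is)) − 1`.
[cite: Conrey1983, §4 (1)–(2)] -/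
theorem levinsonConrey_zeroDetection_phase {Q : ℂ → ℂ} (hab : a < b) (hcd : c < d)
    (hQ : AnalyticOnNhd ℂ Q (Icc a b ×ℂ Icc c d))
    (h_bot : ∀ x ∈ Icc a b, Q (x + c * I) ≠ 0) (h_top : ∀ x ∈ Icc a b, Q (x + d * I) ≠ 0)
    (h_right : ∀ y ∈ Icc c d, Q (b + y * I) ≠ 0)
    (hfin : ∀ t ∈ Ioo c d,
      analyticOrderAt (fun s : ℂ ↦ Q s + conj (Q ((2 * a : ℂ) - conj s))) (a + t * I) ≠ ⊤) :
    ∃ Z : Finset ℝ, (↑Z : Set ℝ) ⊆ Ioo c d ∧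
      (∀ t ∈ Z, Q (a + t * I) + conj (Q ((2 * a : ℂ) - conj ((a : ℂ) + t * I))) = 0) ∧
      ((∫ y in c..d, (deriv Q (a + y * I) / Q (a + y * I)).re) +
          Real.pi * ∑ᶠ t ∈ {t : ℝ | Q (a + t * I) = 0 ∧ t ∈ Ioo c d},
            ((meromorphicOrderAt Q (a + t * I)).untop₀ : ℝ)) / Real.pi - 1 ≤
        ∑ t ∈ Z, ((analyticOrderAt (fun s : ℂ ↦ Q s + conj (Q ((2 * a : ℂ) - conj s)))
          (a + t * I)).toNat : ℝ) := by
  classical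
  set Ξ : ℂ → ℂ := fun s : ℂ ↦ Q s + conj (Q ((2 * a : ℂ) - conj s)) with hΞ
  -- the zeros of `Q` on the left edge
  have hcorner : ((a : ℂ) + c * I) ∈ Icc a b ×ℂ Icc c d :=
    ⟨by simpa using hab.le, by simpa using hcd.le⟩
  have hQc : Q (a + c * I) ≠ 0 := h_bot a ⟨le_rfl, hab.le⟩
  have hQd : Q (a + d * I) ≠ 0 := h_top a ⟨le_rfl, hab.le⟩
  have hSfin : {t : ℝ | Q (a + t * I) = 0 ∧ t ∈ Ioo c d}.Finite :=
    (finite_leftEdge_zeros hab.le hcd.le hQ hcorner hQc).subset fun t ht ↦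
      ⟨ht.1, Ioo_subset_Icc_self ht.2⟩
  set S : Finset ℝ := hSfin.toFinset with hS
  have hSmem : ∀ t, t ∈ S ↔ Q (a + t * I) = 0 ∧ t ∈ Ioo c d := fun t ↦ by
    rw [hS, Set.Finite.mem_toFinset]; rfl
  have hzero : ∀ y ∈ Icc c d, Q (a + y * I) = 0 → y ∈ S := by
    intro y hy h0
    rw [hSmem]
    refine ⟨h0, ?_⟩
    rcases hy.1.eq_or_lt with h | hcy
    · exact absurd h0 (by rw [← h]; exact hQc)
    rcases hy.2.eq_or_lt with h | hyd
    · exact absurd h0 (by rw [h]; exact hQd)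
    exact ⟨hcy, hyd⟩
  have hsub : ((S : Set ℝ)) ⊆ Ioo c d := fun t ht ↦ ((hSmem t).1 ht).2
  have hleft_mem : ∀ y ∈ Icc c d, ((a : ℂ) + y * I) ∈ Icc a b ×ℂ Icc c d := fun y hy ↦
    ⟨by simpa using hab.le, by simpa using hy⟩
  -- multiplicities of `Q` on the edge, as natural numbers
  set n : ℝ → ℕ := fun t ↦ ((meromorphicOrderAt Q (a + t * I)).untop₀).toNat with hn
  have hn_cast : ∀ t ∈ Icc c d, ((n t : ℝ)) = ((meromorphicOrderAt Q (a + t * I)).untop₀ : ℝ) := by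
    intro t ht
    have h0 : (0 : ℤ) ≤ (meromorphicOrderAt Q (a + t * I)).untop₀ :=
      WithTop.untop₀_nonneg.2 (hQ _ (hleft_mem t ht)).meromorphicOrderAt_nonneg
    have e : (((meromorphicOrderAt Q (a + t * I)).untop₀.toNat : ℤ)) =
        (meromorphicOrderAt Q (a + t * I)).untop₀ := Int.toNat_of_nonneg h0
    have e' := congrArg (fun z : ℤ ↦ (z : ℝ)) e
    simp only [Int.cast_natCast] at e'
    exact e'
  have hsum_filter : ∀ t : ℝ, ∑ s ∈ S.filter (· < t), ((meromorphicOrderAt Q (a + s * I)).untop₀ : ℝ) =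
      ∑ s ∈ S.filter (· < t), (n s : ℝ) := fun t ↦
    Finset.sum_congr rfl fun s hs ↦
      (hn_cast s (Ioo_subset_Icc_self (hsub (Finset.mem_coe.2 (Finset.mem_filter.1 hs).1)))).symm
  -- the phase: `φ₀ = arg Q(a+ic)`, `Φc(t) = φ₀ + ∫_c^t Re (Q'/Q)`
  set φ₀ : ℝ := arg (Q (a + c * I)) with hφ₀_def
  have hφ₀ : Q (a + c * I) = ‖Q (a + c * I)‖ * exp (φ₀ * I) :=
    (Complex.norm_mul_exp_arg_mul_I _).symm
  have hint : IntervalIntegrable (fun y : ℝ ↦ (deriv Q (a + y * I) / Q (a + y * I)).re) volume c d :=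
    intervalIntegrable_re_logDeriv_left hab hcd hQ h_bot h_top h_right
  set Φc : ℝ → ℝ := fun t ↦ φ₀ + ∫ u in c..t, (deriv Q (a + u * I) / Q (a + u * I)).re with hΦc
  have hΦc_cont : ContinuousOn Φc (Icc c d) := by
    have h := intervalIntegral.continuousOn_primitive_interval' hint left_mem_uIcc
    rw [uIcc_of_le hcd.le] at h
    exact continuousOn_const.add h
  -- level crossings
  obtain ⟨F, hFsub, hFdisj, hFcos, hFcnt⟩ :=
    exists_finset_cos_jumpPhase_eq_zero hcd hΦc_cont hsub n
  -- `Ξ` is analytic on the edge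
  have hΞ_an : ∀ t ∈ Icc c d, AnalyticAt ℂ Ξ (a + t * I) := by
    intro t ht
    refine (hQ _ (hleft_mem t ht)).add (analyticAt_reflect ?_)
    rw [reflect_ofReal_add_mul_I]
    exact hQ _ (hleft_mem t ht)
  -- (i) on `F`: `Re Q = 0`, so `Ξ = 0`, and the order of `Ξ` is `≥ 1`
  have hF_zero : ∀ t ∈ F, Ξ (a + t * I) = 0 := by
    intro t ht
    have htI : t ∈ Ioo c d := hFsub (Finset.mem_coe.2 ht)
    have htIcc : t ∈ Icc c d := Ioo_subset_Icc_self htI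
    have htS : t ∉ S := Finset.disjoint_left.1 hFdisj ht
    have hph := leftEdge_phase_eq_sum hab hcd S Q hQ hQc hQd hzero hsub φ₀ hφ₀ t htIcc htS
    rw [hsum_filter t] at hph
    have hcos := hFcos t ht
    -- `Re Q(a+it) = ‖Q(a+it)‖ cos Φ(t) = 0`
    have hre : (Q (a + t * I)).re = 0 := by
      rw [hph, re_ofReal_mul, Complex.exp_ofReal_mul_I_re]
      simp only [hΦc] at hcos
      rw [show φ₀ + (∫ u in c..t, (deriv Q (a + u * I) / Q (a + u * I)).re) +
          Real.pi * ∑ s ∈ S.filter (· < t), (n s : ℝ) =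
        φ₀ + (∫ u in c..t, (deriv Q (a + u * I) / Q (a + u * I)).re) +
          Real.pi * ∑ s ∈ S.filter (· < t), (n s : ℝ) from rfl, hcos, mul_zero]
    show Q (a + t * I) + conj (Q ((2 * a : ℂ) - conj ((a : ℂ) + t * I))) = 0
    rw [reflect_ofReal_add_mul_I, Complex.add_conj, hre]
    simp
  have hF_order : ∀ t ∈ F, 1 ≤ (analyticOrderAt Ξ (a + t * I)).toNat := by
    intro t ht
    have htI : t ∈ Ioo c d := hFsub (Finset.mem_coe.2 ht)
    refine le_toNat_of_coe_le ?_ (hfin t htI)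
    rw [Nat.cast_one, Order.one_le_iff_ne_zero]
    intro h0
    exact ((hΞ_an t (Ioo_subset_Icc_self htI)).analyticOrderAt_eq_zero.1 h0) (hF_zero t ht)
  -- (ii) on `S`: the order of `Ξ` is `≥ n + flag`
  have hS_order : ∀ s ∈ S, n s + (if Real.cos (Φc s + Real.pi * ∑ x ∈ S.filter (· < s), (n x : ℝ)) = 0
      then 1 else 0) ≤ (analyticOrderAt Ξ (a + s * I)).toNat := by
    intro s hsS
    obtain ⟨hQs, hsI⟩ := (hSmem s).1 hsS
    set ρ : ℂ := (a : ℂ) + s * I with hρ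
    have hρK : ρ ∈ Icc a b ×ℂ Icc c d := hleft_mem s (Ioo_subset_Icc_self hsI)
    have hne_top : analyticOrderAt Q ρ ≠ ⊤ :=
      analyticOrderAt_ne_top_of_reProdIm hab.le hcd.le hQ hcorner hQc hρK
    obtain ⟨g, hg_an, hg_ne, hfg⟩ := (hQ ρ hρK).analyticOrderAt_ne_top.mp hne_top
    set m : ℕ := analyticOrderNatAt Q ρ with hm
    have hfg' : ∀ᶠ z in 𝓝 ρ, Q z = (z - ρ) ^ m * g z := by
      filter_upwards [hfg] with z hz
      rw [hz, smul_eq_mul]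
    -- `n s = m`
    have hnm : n s = m := by
      rw [hn]
      simp only
      rw [← hρ, (hQ ρ hρK).meromorphicOrderAt_eq, ← Nat.cast_analyticOrderNatAt hne_top]
      simp [hm]
    rw [hnm]
    refine le_toNat_of_coe_le ?_ (hfin s hsI)
    by_cases hflag : Real.cos (Φc s + Real.pi * ∑ x ∈ S.filter (· < s), (n x : ℝ)) = 0
    · rw [if_pos hflag]
      -- the flag says `Re ((-i)^m g(ρ)) = 0`
      have hexp := exp_leftEdge_phase_at_zero hab hcd S hQ hQc hQd hzero hsub hint hφ₀ hsS
        hg_an hg_ne hfg'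
      rw [hsum_filter s] at hexp
      have hre := congrArg Complex.re hexp
      rw [Complex.exp_ofReal_mul_I_re] at hre
      have hcos0 : Real.cos (φ₀ + (∫ u in c..s, (deriv Q (a + u * I) / Q (a + u * I)).re) +
          Real.pi * ∑ x ∈ S.filter (· < s), (n x : ℝ)) = 0 := hflag
      have h1 : ((-I) ^ m * (g (a + s * I) / (‖g (a + s * I)‖ : ℂ))).re = 0 := by
        rw [← hre]; exact hcos0
      rw [← mul_div_assoc, Complex.div_ofReal_re, div_eq_zero_iff] at h1
      have hflag' : ((-I) ^ m * g ρ).re = 0 := h1.resolve_right (norm_ne_zero_iff.2 hg_ne)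
      exact succ_le_analyticOrderAt_add_reflect hg_an hfg' hflag'
    · rw [if_neg hflag, add_zero]
      exact (natCast_le_analyticOrderAt_add_reflect hg_an hfg').2
  -- (iii) assemble: `Z = F ∪ S`
  refine ⟨F ∪ S, ?_, ?_, ?_⟩
  · intro t ht
    rw [Finset.coe_union] at ht
    rcases ht with ht | ht
    · exact hFsub ht
    · exact hsub ht
  · intro t ht
    rw [Finset.mem_union] at ht
    rcases ht with ht | ht
    · exact hF_zero t ht
    · obtain ⟨hQt, _⟩ := (hSmem t).1 ht
      show Q (a + t * I) + conj (Q ((2 * a : ℂ) - conj ((a : ℂ) + t * I))) = 0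
      rw [reflect_ofReal_add_mul_I, hQt, map_zero, add_zero]
  · -- the count
    have hΦcc : Φc c = φ₀ := by simp [hΦc]
    have hΦcd : Φc d = φ₀ + ∫ u in c..d, (deriv Q (a + u * I) / Q (a + u * I)).re := rfl
    have hsumS : ∑ s ∈ S, (n s : ℝ) = ∑ᶠ t ∈ {t : ℝ | Q (a + t * I) = 0 ∧ t ∈ Ioo c d},
        ((meromorphicOrderAt Q (a + t * I)).untop₀ : ℝ) := by
      rw [finsum_mem_eq_finite_toFinset_sum _ hSfin]
      exact Finset.sum_congr rfl fun s hs ↦ hn_cast s (Ioo_subset_Icc_self (hsub (Finset.mem_coe.2 hs)))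
    rw [hΦcc, hΦcd, hsumS] at hFcnt
    have hlhs : (φ₀ + (∫ u in c..d, (deriv Q (a + u * I) / Q (a + u * I)).re) +
        Real.pi * ∑ᶠ t ∈ {t : ℝ | Q (a + t * I) = 0 ∧ t ∈ Ioo c d},
          ((meromorphicOrderAt Q (a + t * I)).untop₀ : ℝ) - φ₀) =
        (∫ y in c..d, (deriv Q (a + y * I) / Q (a + y * I)).re) +
          Real.pi * ∑ᶠ t ∈ {t : ℝ | Q (a + t * I) = 0 ∧ t ∈ Ioo c d},
            ((meromorphicOrderAt Q (a + t * I)).untop₀ : ℝ) := by ring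
    rw [hlhs] at hFcnt
    refine hFcnt.trans ?_
    rw [Finset.sum_union hFdisj, Finset.card_eq_sum_ones, Nat.cast_sum, Nat.cast_one]
    refine add_le_add (Finset.sum_le_sum fun t ht ↦ ?_) (Finset.sum_le_sum fun s hs ↦ ?_)
    · exact_mod_cast hF_order t ht
    · have h := hS_order s hs
      have h' : ((n s + (if Real.cos (Φc s + Real.pi * ∑ x ∈ S.filter (· < s), (n x : ℝ)) = 0
          then 1 else 0) : ℕ) : ℝ) ≤ ((analyticOrderAt Ξ (a + s * I)).toNat : ℝ) := by
        exact_mod_cast h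
      push_cast at h'
      exact h'

/-- **Levinson–Conrey zero detection** (Conrey 1983, §4, (1)–(3), generic form). Let `Q` be
analytic at every point of the closed rectangle `R = [a,b] × [c,d]` (`a < b`, `c < d`), non-zero on
the bottom, top and right edges, and suppose `Q + Q♯` (`Q♯(s) = conj Q(2a − s̄)`) has finite order
at every point of the open left edge. Then there is a finite set `Z ⊆ (c, d)` of ordinates of
zeros of `Q + Q♯` on the left edge whose multiplicities add up to at least
`(1/π)(Im ∫_a^b (Q'/Q)(x+ic) dx − Im ∫_a^b (Q'/Q)(x+id) dx + ∫_c^d Re (Q'/Q)(b+it) dt) − 2N − 1`,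
`N = Σ_{ρ ∈ R°, Q(ρ)=0} m(ρ)` the number of zeros of `Q` inside `R`.
[cite: Conrey1983, §4 (1)–(3)] -/
theorem levinsonConrey_zeroDetection {Q : ℂ → ℂ} (hab : a < b) (hcd : c < d)
    (hQ : AnalyticOnNhd ℂ Q (Icc a b ×ℂ Icc c d))
    (h_bot : ∀ x ∈ Icc a b, Q (x + c * I) ≠ 0) (h_top : ∀ x ∈ Icc a b, Q (x + d * I) ≠ 0)
    (h_right : ∀ y ∈ Icc c d, Q (b + y * I) ≠ 0)
    (hfin : ∀ t ∈ Ioo c d,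
      analyticOrderAt (fun s : ℂ ↦ Q s + conj (Q ((2 * a : ℂ) - conj s))) (a + t * I) ≠ ⊤) :
    ∃ Z : Finset ℝ, (↑Z : Set ℝ) ⊆ Ioo c d ∧
      (∀ t ∈ Z, Q (a + t * I) + conj (Q ((2 * a : ℂ) - conj ((a : ℂ) + t * I))) = 0) ∧
      ((∫ x in a..b, deriv Q (x + c * I) / Q (x + c * I)).im -
          (∫ x in a..b, deriv Q (x + d * I) / Q (x + d * I)).im +
          (∫ y in c..d, (deriv Q (b + y * I) / Q (b + y * I)).re)) / Real.pi -
        2 * ∑ᶠ ρ ∈ {ρ : ℂ | Q ρ = 0 ∧ ρ ∈ Ioo a b ×ℂ Ioo c d}, ((meromorphicOrderAt Q ρ).untop₀ : ℝ) -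
        1 ≤
        ∑ t ∈ Z, ((analyticOrderAt (fun s : ℂ ↦ Q s + conj (Q ((2 * a : ℂ) - conj s)))
          (a + t * I)).toNat : ℝ) := by
  obtain ⟨Z, hZ, hZ0, hcnt⟩ := levinsonConrey_zeroDetection_phase hab hcd hQ h_bot h_top h_right hfin
  refine ⟨Z, hZ, hZ0, le_trans (le_of_eq ?_) hcnt⟩
  rw [integral_re_logDeriv_left_add_finsum_eq hab hcd hQ h_bot h_top h_right]
  have hπ : Real.pi ≠ 0 := Real.pi_ne_zero
  field_simp

end Literature.Analysis.Complex

end
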